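import Summits.Ventures.AbcSig.Rows.XTemplateHalves
import Summits.Ventures.AbcSig.Levels.N8672

/-!
# Venture AbcSig — PARITY-HALF ROW `C2aL271A0xyoddV2`: `xⁿ + 271^m·yⁿ = z²`, `xy` odd (class `a = 0`, [BS04, Thm 1.6] wording) over the NORM-FORM level file 8672 = 32·271 (GENERATED by p-lean g4 `gen4/halfrow.py`)

HONEST FRAMING. A row of a COMPUTATION cell (`pub-abcsig`); a CONDITIONAL theorem, no claim on ABC or any summit.
Hypotheses: `BS04Package` (CITED: [BS04] Lemma 3.3 + (3.1) + Lemma 4.2); `DataComplete 8672` + `RefinesCPSymAll 8672` (COMPUTED: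
certified engine-1 level file; norm-form certificates `Sieve/CharpolyCert.lean`, prime-ideal trees where the norm form is weaker);
the listed per-orbit exclusions `hX_…` (CITED: the row of record's module closures — nothing of them is checked here).
Only the parity half living at the single level 32·271 is claimed (the complementary half needs level 2·271, not certified).
Exponent range: prime `n ≥ 11`, `n ≠ 271`; `1 ≤ m < n`.
CITED per the row of record (v2): the degree-30 pair 8672.7/.8 at n = 11 by MODULE M4 IN THE RE-EXPRESSED PRESENTATION (M4re; lead RULING LABEL-AUDIT (2); p1 + engine-2 second implementation) and at n = 17 by M4 (Kraus) / M6c-old (congruence to the ℓ-stabilised CM form 32a modulo (17, θ)); the degree-28 pair 8672.5/.6 at 13 and 17 is killed IN THE KERNEL here (prime-ideal trees in the re-based 13-regular presentation θ = c_5, Sieve/Certificate.lean). v2 residual: none (v1: {11}).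
Row of record: `census/rows/C2a/C2a-l271-a0-xyodd.md` (sha16 `b85fee766a1df066`; v2 R8-signed 2026-08-23T04:00:13Z by referee (ref-g24); module M4re).
-/

namespace Summit.Ventures.AbcSig

/-- Parity-half row `C2aL271A0xyoddV2` (`xⁿ + 271^m·yⁿ = z²`, `xy` odd (class `a = 0`, [BS04, Thm 1.6] wording)); prime `n ≥ 11`, `n ≠ 271`; conditional on the named hypotheses. -/
theorem xrow_C2aL271A0xyoddV2 (M : NewformModel) (hP : M.BS04Package)
    (hD8672 : M.DataComplete 8672 level8672Orbits) (hCP8672 : M.RefinesCPSymAll 8672 level8672CP)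
    (n : ℕ) (hn : n.Prime) (hmin : 11 ≤ n) (hnℓ : n ≠ 271) (m : ℕ) (hm : 1 ≤ m) (hmn : m < n)
    (hX_orbit_8672_7 : n ∈ ([11, 17] : List ℕ) → M.Excludes 8672 orbit_8672_7
      (famB (2 ^ 0 * 271 ^ m) n (fun _ _ => True)))
    (hX_orbit_8672_8 : n ∈ ([11, 17] : List ℕ) → M.Excludes 8672 orbit_8672_8
      (famB (2 ^ 0 * 271 ^ m) n (fun _ _ => True)))
    (x y z : ℤ) (hxy : ¬ 2 ∣ x * y) (hxy1 : x * y ≠ 1) (hxy2 : x * y ≠ -1) : ¬ IsPrimitiveSolution 1 (2 ^ 0 * 271 ^ m) 1 n x y z := by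
  have hℓ : Nat.Prime 271 := by norm_num
  have h7 : 7 ≤ n := by omega
  exact xrowC2a_a0_xyodd 271 hℓ (by norm_num) M hP n hn h7 hnℓ hD8672 m hm hmn
    (level8672_sieve M hP hCP8672 n hn h7 (fun o => M.Excludes 8672 o
      (famB (2 ^ 0 * 271 ^ m) n (fun _ _ => True)) ∨ M.ExcludesStd 8672 o n) (fun _ h => Or.inr h) (fun hmem => by
      obtain rfl : n = 7 := by simpa using hmem
      omega) (fun hmem => by
      obtain rfl : n = 7 := by simpa using hmem
      omega) (fun hmem => by
      obtain rfl : n = 7 := by simpa using hmem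
      omega) (fun hmem => by
      obtain rfl : n = 7 := by simpa using hmem
      omega) (fun hmem => by
      rcases (by simpa using hmem : n = 7 ∨ n = 11 ∨ n = 17) with rfl | rfl | rfl
      · omega
      · exact Or.inl (hX_orbit_8672_7 (by simp))
      · exact Or.inl (hX_orbit_8672_7 (by simp))) (fun hmem => by
      rcases (by simpa using hmem : n = 7 ∨ n = 11 ∨ n = 17) with rfl | rfl | rfl
      · omega
      · exact Or.inl (hX_orbit_8672_8 (by simp))
      · exact Or.inl (hX_orbit_8672_8 (by simp))))
    x y z hxy hxy1 hxy2

end Summit.Ventures.AbcSig
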